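import Literature.Analysis.FluidPDE.SereginSverakPressureMonotone
import Literature.Analysis.FluidPDE.SereginSverak2002ACriterion
import HarnessLib

/-!
# One-sided pressure bounds: smallness of the smoothed scaled energy at ONE scale on a final
# time window already gives boundedness at the final time

Analysis/FluidPDE proof file (theorems only; no definitions, no named facts) on the discharge
path of the named fact `Literature.Analysis.FluidPDE.seregin_sverak_2002`
(`SereginSverakPressure.lean`; G. Seregin, V. Šverák, *Navier–Stokes equations with lower bounds
on the pressure*, Arch. Ration. Mech. Anal. **163** (2002) 65–86, main theorem; cite-only on this
hub). It combines the two inputs of the tree that concern the scaled kinetic energy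
`A(r; z₀) = sup_t r⁻¹ ∫_{B_r(x₀)} |u(t)|²`:

* the **downward monotonicity** of the probe-smoothed scaled energy
  `F(s; x₀, t) = ∫ |u(t, x)|² s⁻¹ P̄(|x - x₀|²/s²) dx` under either one-sided bound of the fact
  (`SereginSverak2002.scaledEnergy_le_of_oneSided`, `SereginSverakPressureMonotone.lean`):
  `F(s) ≤ F(S) + (3/2)(2K) c_P (S² - s²)` for `s ≤ S`, and `s⁻¹ ∫_{B(x₀, s/2)} |u|² ≤ F(s)`;
* the **`A`-criterion at the final time** (Seregin–Šverák 2002, Lemma 3.3, in the tree as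
  `SereginSverak2002.isBackwardBoundedAt_of_cknAEss_le`, `SereginSverak2002ACriterion.lean`):
  `A(r; (T, x₀)) ≤ ε` for all small `r` gives `IsBackwardBoundedAt u T x₀`.

Main result (`SereginSverak2002.isBackwardBoundedAt_of_probeEnergy_le`): there is a universal
`δ > 0` such that, for a classical Leray–Hopf solution on `[0, T)` (`ν = 1`) with
`|u|²/2 + p̃ ≤ K` or `p̃ ≥ -K` on `(0, T) × ℝ³` (`K ≥ 0`), a centre `x₀`, a scale `r₁ > 0` with
`K r₁² ≤ δ` and a time `t₁ < T`: if `F(r₁; x₀, t) ≤ δ` for all `t ∈ (t₁, T) ∩ (0, T)`, then `u` is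
bounded near `(T, x₀)`. In words: under a one-sided pressure bound, smallness of the scaled energy
at a SINGLE scale, uniformly on a final time window, propagates to all smaller scales (the
monotonicity), which is the hypothesis of Lemma 3.3. Contrapositively
(`SereginSverak2002.frequently_probeEnergy_gt_of_not_isBackwardBoundedAt`): at a point where `u` is
not backward bounded, for every small scale `r₁` the smoothed scaled energy `F(r₁; x₀, t)`
exceeds `δ` at times `t` arbitrarily close to `T` — the form consumed by the blow-up step of the
reconstruction of §4 of the paper (see `RadialSolenoidalVanishing.lean`).

The probe pair `(P, P̄)` is any pair with the properties produced by
`SereginSverak2002.exists_pressureProbePair`; it is passed as a parameter so that later files can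
fix one pair once and for all.

## References

* G. Seregin, V. Šverák, Arch. Ration. Mech. Anal. 163 (2002), 65–86, Lemma 3.3 and the main
  theorem. [SereginSverak2002]
* T. Barker, W. Wang, J. Differential Equations 365 (2023) = arXiv:2111.15444, §3, Lemma 1
  (restatement of Lemma 3.3). [BarkerWang2023]
-/

noncomputable section

open _root_.MeasureTheory Set Function Filter _root_.Topology Metric Real
open scoped NNReal ENNReal RealInnerProductSpace ContDiff

namespace Literature.Analysis.FluidPDE

namespace SereginSverak2002

variable {P Pb : ℝ → ℝ}

/-- **The scaled ball energy is below the probe energy**: `s⁻¹ ∫_{B(x₀, s/2)} |w|² ≤ F(s)` for a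
probe pair (`P̄ = 1` on `σ ≤ 1/4`, `P̄ ≥ 0`) and `w` of finite energy. [folklore] -/
theorem inv_mul_setIntegral_ball_half_le_probeEnergy (hPb : ContDiff ℝ ∞ Pb)
    (hPbnn : ∀ σ, 0 ≤ Pb σ) (hPble : ∀ σ, Pb σ ≤ 1) (hPb1 : ∀ σ, σ ≤ 1 / 4 → Pb σ = 1)
    {w : EuclideanSpace ℝ (Fin 3) → EuclideanSpace ℝ (Fin 3)} (hwc : Continuous w)
    (hL2 : Integrable fun y => ‖w y‖ ^ 2) (x₀ : EuclideanSpace ℝ (Fin 3)) {s : ℝ} (hs : 0 < s) :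
    s⁻¹ * ∫ x in ball x₀ (s / 2), ‖w x‖ ^ 2 ≤
      ∫ x, ‖w x‖ ^ 2 * (s⁻¹ * Pb (‖x - x₀‖ ^ 2 / s ^ 2)) := by
  have hn : Continuous fun x : EuclideanSpace ℝ (Fin 3) => ‖x - x₀‖ ^ 2 / s ^ 2 :=
    ((continuous_id.sub continuous_const).norm.pow 2).div_const _
  have hk_int : Integrable fun x => ‖w x‖ ^ 2 * (s⁻¹ * Pb (‖x - x₀‖ ^ 2 / s ^ 2)) := by
    refine (hL2.mul_const |s⁻¹|).mono' ?_ (Eventually.of_forall fun x => ?_)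
    · exact ((hwc.norm.pow 2).mul (continuous_const.mul
        (hPb.continuous.comp hn))).aestronglyMeasurable
    · rw [Real.norm_eq_abs, abs_mul, abs_of_nonneg (sq_nonneg _), abs_mul,
        abs_of_nonneg (hPbnn _)]
      calc ‖w x‖ ^ 2 * (|s⁻¹| * Pb (‖x - x₀‖ ^ 2 / s ^ 2)) ≤ ‖w x‖ ^ 2 * (|s⁻¹| * 1) := by
            gcongr; exact hPble _
        _ = ‖w x‖ ^ 2 * |s⁻¹| := by ring
  rw [← integral_const_mul, ← integral_indicator measurableSet_ball]
  refine integral_mono ?_ hk_int fun x => ?_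
  · exact ((hL2.const_mul _).indicator measurableSet_ball)
  · by_cases hx : x ∈ ball x₀ (s / 2)
    · rw [indicator_of_mem hx]
      have hτ : ‖x - x₀‖ ^ 2 / s ^ 2 ≤ 1 / 4 := by
        rw [mem_ball, dist_eq_norm] at hx
        rw [div_le_iff₀ (by positivity)]
        nlinarith [norm_nonneg (x - x₀)]
      rw [hPb1 _ hτ]
      nlinarith [sq_nonneg ‖w x‖, inv_pos.2 hs]
    · rw [indicator_of_notMem hx]
      exact mul_nonneg (sq_nonneg _) (mul_nonneg (inv_pos.2 hs).le (hPbnn _))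

/-- **The scaled kinetic energy `A` of the ε-regularity theory on a backward cylinder is small as
soon as the probe energy at one larger scale is small on its time window** (one-sided pressure
bound, classical Leray–Hopf solution, `ν = 1`). For a probe pair, `K ≥ 0` with the one-sided
bound, `0 < r`, `4 r ≤ r₁`... precisely: if `2r ≤ r₁`, `r² ≤ T - t₁`, `0 ≤ t₁` and
`F(r₁; x₀, t) ≤ δ` for `t ∈ (t₁, T)`, then `A(r; (T, x₀)) ≤ 2(δ + 4πK r₁²)` (as an extended real).
[folklore] -/
theorem cknAEss_le_of_probeEnergy_le (hP : ContDiff ℝ ∞ P) (hPb : ContDiff ℝ ∞ Pb)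
    (hode : ∀ σ, Pb σ + 2 / 3 * σ * deriv Pb σ = P σ) (hP0 : ∀ σ, 1 ≤ σ → P σ = 0)
    (hPnn : ∀ σ, 0 ≤ P σ) (hPle : ∀ σ, P σ ≤ Pb σ) (hPble : ∀ σ, Pb σ ≤ 1)
    (hPb1 : ∀ σ, σ ≤ 1 / 4 → Pb σ = 1) (hPb' : ∀ σ, deriv Pb σ ≤ 0)
    {T : ℝ} {u : ℝ → EuclideanSpace ℝ (Fin 3) → EuclideanSpace ℝ (Fin 3)}
    {p : ℝ → EuclideanSpace ℝ (Fin 3) → ℝ}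
    (hsol : IsClassicalNSSolutionOn (Ico 0 T) 1 0 u p) (hLH : IsLerayHopfOn T 1 0 (u 0) u)
    {K : ℝ} (hK : 0 ≤ K)
    (hone : (∀ t ∈ Ioo 0 T, ∀ x, ‖u t x‖ ^ 2 / 2 + normalisedPressure (u t) x ≤ K) ∨
      (∀ t ∈ Ioo 0 T, ∀ x, -K ≤ normalisedPressure (u t) x))
    (x₀ : EuclideanSpace ℝ (Fin 3)) {r₁ t₁ δ r : ℝ} (ht₁ : 0 ≤ t₁) (hr : 0 < r)
    (hrr₁ : 2 * r ≤ r₁) (hrt : r ^ 2 ≤ T - t₁)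
    (hF : ∀ t ∈ Ioo t₁ T,
      ∫ x, ‖u t x‖ ^ 2 * (r₁⁻¹ * Pb (‖x - x₀‖ ^ 2 / r₁ ^ 2)) ≤ δ) :
    cknAEss r (T, x₀) u ≤ ENNReal.ofReal (2 * (δ + 4 * π * K * r₁ ^ 2)) := by
  have hPbnn : ∀ σ, 0 ≤ Pb σ := fun σ => (hPnn σ).trans (hPle σ)
  have hr₁ : 0 < r₁ := by linarith
  have hcP := integral_probe_le hP hP0 (fun σ => (hPle σ).trans (hPble σ))
  have hcP0 : 0 ≤ ∫ y : EuclideanSpace ℝ (Fin 3), P (‖y‖ ^ 2) := integral_nonneg fun y => hPnn _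
  -- the bound on every slice of the window
  have hslice : ∀ t ∈ Ioo (T - r ^ 2) T,
      r⁻¹ * ∫ x in ball x₀ r, ‖u t x‖ ^ 2 ≤ 2 * (δ + 4 * π * K * r₁ ^ 2) := by
    intro t ht
    have ht0 : t ∈ Ioo 0 T := ⟨by linarith [ht.1], ht.2⟩
    have ht1 : t ∈ Ioo t₁ T := ⟨by linarith [ht.1], ht.2⟩
    have hw : ContDiff ℝ ∞ (u t) := hsol.contDiff_velocity ⟨ht0.1.le, ht0.2⟩
    have hL2 : Integrable fun x => ‖u t x‖ ^ 2 :=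
      (hLH.memLp t ⟨ht0.1.le, ht0.2.le⟩).integrable_norm_pow two_ne_zero
    -- the one-sided hypothesis on the slice, with `M = 2K`
    have hone' : (∀ x ∈ ball x₀ r₁, -(2 * K) ≤ normalisedPressure (u t) x) ∨
        (∀ x ∈ ball x₀ r₁, ‖u t x‖ ^ 2 + 2 * normalisedPressure (u t) x ≤ 2 * K) := by
      rcases hone with h | h
      · exact Or.inr fun x _ => by have := h t ht0 x; linarith
      · exact Or.inl fun x _ => by have := h t ht0 x; linarith
    -- monotonicity from the scale `2r` up to `r₁`
    have hmono := scaledEnergy_le_of_oneSided hP hPb hode hP0 hPnn hPle hPble hPb' hw hL2 x₀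
      (by linarith : 0 ≤ 2 * K) (by linarith : 0 < 2 * r) hrr₁ hone'
    -- the ball energy at scale `r` is below `F(2r)`
    have hlow := inv_mul_setIntegral_ball_half_le_probeEnergy hPb hPbnn hPble hPb1 hw.continuous
      hL2 x₀ (by linarith : 0 < 2 * r)
    rw [show 2 * r / 2 = r by ring] at hlow
    have hFt := hF t ht1
    have hKterm : 3 / 2 * (2 * K) * (∫ y : EuclideanSpace ℝ (Fin 3), P (‖y‖ ^ 2)) *
        (r₁ ^ 2 - (2 * r) ^ 2) ≤ 4 * π * K * r₁ ^ 2 := by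
      have h1 : 3 / 2 * (2 * K) * (∫ y : EuclideanSpace ℝ (Fin 3), P (‖y‖ ^ 2)) ≤
          3 / 2 * (2 * K) * (4 * π / 3) := mul_le_mul_of_nonneg_left hcP (by positivity)
      have h2 : r₁ ^ 2 - (2 * r) ^ 2 ≤ r₁ ^ 2 := by nlinarith
      have h3 : 0 ≤ r₁ ^ 2 - (2 * r) ^ 2 := by nlinarith
      calc 3 / 2 * (2 * K) * (∫ y : EuclideanSpace ℝ (Fin 3), P (‖y‖ ^ 2)) * (r₁ ^ 2 - (2 * r) ^ 2)
          ≤ 3 / 2 * (2 * K) * (4 * π / 3) * r₁ ^ 2 :=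
            mul_le_mul h1 h2 h3 (by positivity)
        _ = 4 * π * K * r₁ ^ 2 := by ring
    have hmain : (2 * r)⁻¹ * ∫ x in ball x₀ r, ‖u t x‖ ^ 2 ≤ δ + 4 * π * K * r₁ ^ 2 := by
      linarith
    have : r⁻¹ * ∫ x in ball x₀ r, ‖u t x‖ ^ 2 = 2 * ((2 * r)⁻¹ * ∫ x in ball x₀ r, ‖u t x‖ ^ 2) := by
      rw [mul_inv]; ring
    rw [this]
    linarith
  -- the essential supremum
  refine essSup_le_of_ae_le _ ((ae_restrict_iff' measurableSet_Ioo).2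
    (Eventually.of_forall fun t ht => ?_))
  have ht0 : t ∈ Ioo 0 T := ⟨by linarith [ht.1], ht.2⟩
  have hL2 : Integrable fun x => ‖u t x‖ ^ 2 :=
    (hLH.memLp t ⟨ht0.1.le, ht0.2.le⟩).integrable_norm_pow two_ne_zero
  have hint : IntegrableOn (fun x => ‖u t x‖ ^ 2) (ball x₀ r) := hL2.integrableOn
  have hlin : ∫⁻ x in ball x₀ r, ‖u t x‖ₑ ^ 2 = ENNReal.ofReal (∫ x in ball x₀ r, ‖u t x‖ ^ 2) := by
    rw [ofReal_integral_eq_lintegral_ofReal hint (Eventually.of_forall fun x => by positivity)]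
    refine lintegral_congr fun x => ?_
    rw [← ofReal_norm, ← ENNReal.ofReal_pow (norm_nonneg _)]
  have hI0 : 0 ≤ ∫ x in ball x₀ r, ‖u t x‖ ^ 2 := integral_nonneg fun x => by positivity
  show (ENNReal.ofReal r)⁻¹ * ∫⁻ x in ball (T, x₀).2 r, ‖u t x‖ₑ ^ 2 ≤
    ENNReal.ofReal (2 * (δ + 4 * π * K * r₁ ^ 2))
  rw [show (T, x₀).2 = x₀ from rfl, hlin, ← ENNReal.ofReal_inv_of_pos hr,
    ← ENNReal.ofReal_mul (inv_pos.2 hr).le]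
  exact ENNReal.ofReal_le_ofReal (hslice t ht)

/-- **Smallness at one scale on a final window gives boundedness at the final time.** There is
a universal `δ > 0` such that: for a classical solution of the unforced Navier–Stokes system on
`ℝ³ × [0, T)` (`ν = 1`) which is Leray–Hopf on `[0, T)`, under `|u|²/2 + p̃ ≤ K` or `p̃ ≥ -K` on
`(0, T) × ℝ³` (`K ≥ 0`), for any probe pair, any centre `x₀`, scale `r₁ > 0` with `K r₁² ≤ δ`
and time `0 ≤ t₁ < T`: if the probe energy satisfies `F(r₁; x₀, t) ≤ δ` for all `t ∈ (t₁, T)`,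
then `IsBackwardBoundedAt u T x₀`. Proof: by the previous theorem `A(r; (T, x₀)) ≤ 2δ(1 + 4π) ≤ ε`
for all `0 < r < min(r₁/2, √(T - t₁))`, and Lemma 3.3 (`isBackwardBoundedAt_of_cknAEss_le`)
applies. [cite: SereginSverak2002, Lemma 3.3 (restated verbatim BarkerWang2023 §3 Lemma 1)] -/
theorem isBackwardBoundedAt_of_probeEnergy_le (hP : ContDiff ℝ ∞ P) (hPb : ContDiff ℝ ∞ Pb)
    (hode : ∀ σ, Pb σ + 2 / 3 * σ * deriv Pb σ = P σ) (hP0 : ∀ σ, 1 ≤ σ → P σ = 0)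
    (hPnn : ∀ σ, 0 ≤ P σ) (hPle : ∀ σ, P σ ≤ Pb σ) (hPble : ∀ σ, Pb σ ≤ 1)
    (hPb1 : ∀ σ, σ ≤ 1 / 4 → Pb σ = 1) (hPb' : ∀ σ, deriv Pb σ ≤ 0) :
    ∃ δ : ℝ, 0 < δ ∧
    ∀ (T : ℝ) (u : ℝ → EuclideanSpace ℝ (Fin 3) → EuclideanSpace ℝ (Fin 3))
      (p : ℝ → EuclideanSpace ℝ (Fin 3) → ℝ), 0 < T →
      IsClassicalNSSolutionOn (Ico 0 T) 1 0 u p → IsLerayHopfOn T 1 0 (u 0) u →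
      ∀ (K : ℝ), 0 ≤ K →
      ((∀ t ∈ Ioo 0 T, ∀ x, ‖u t x‖ ^ 2 / 2 + normalisedPressure (u t) x ≤ K) ∨
        (∀ t ∈ Ioo 0 T, ∀ x, -K ≤ normalisedPressure (u t) x)) →
      ∀ (x₀ : EuclideanSpace ℝ (Fin 3)) (r₁ t₁ : ℝ), 0 < r₁ → 0 ≤ t₁ → t₁ < T →
        K * r₁ ^ 2 ≤ δ →
        (∀ t ∈ Ioo t₁ T, ∫ x, ‖u t x‖ ^ 2 * (r₁⁻¹ * Pb (‖x - x₀‖ ^ 2 / r₁ ^ 2)) ≤ δ) →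
        IsBackwardBoundedAt u T x₀ := by
  obtain ⟨ε, hε, hA⟩ := isBackwardBoundedAt_of_cknAEss_le
  refine ⟨ε / (2 * (1 + 4 * π)), by positivity, ?_⟩
  intro T u p hT hsol hLH K hK hone x₀ r₁ t₁ hr₁ ht₁ ht₁T hKr hF
  -- the range of admissible scales
  set R : ℝ := min (r₁ / 2) (Real.sqrt (T - t₁)) with hR
  have hR0 : 0 < R := lt_min (by positivity) (Real.sqrt_pos.2 (by linarith))
  refine hA T u p hT hsol hLH x₀ R hR0 fun r hr => ?_
  have hr0 : 0 < r := hr.1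
  have hrr₁ : 2 * r ≤ r₁ := by
    have : r ≤ r₁ / 2 := hr.2.le.trans (min_le_left _ _)
    linarith
  have hrt : r ^ 2 ≤ T - t₁ := by
    have h1 : r ≤ Real.sqrt (T - t₁) := hr.2.le.trans (min_le_right _ _)
    have h2 : r ^ 2 ≤ Real.sqrt (T - t₁) ^ 2 := pow_le_pow_left₀ hr0.le h1 2
    rwa [Real.sq_sqrt (by linarith)] at h2
  have hmain := cknAEss_le_of_probeEnergy_le hP hPb hode hP0 hPnn hPle hPble hPb1 hPb' hsol hLH hK
    hone x₀ ht₁ hr0 hrr₁ hrt hF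
  refine hmain.trans (ENNReal.ofReal_le_ofReal ?_)
  -- `2 (δ + 4π K r₁²) ≤ 2 (δ + 4π δ) = ε`
  have h1 : 4 * π * K * r₁ ^ 2 ≤ 4 * π * (ε / (2 * (1 + 4 * π))) := by
    have : 4 * π * K * r₁ ^ 2 = 4 * π * (K * r₁ ^ 2) := by ring
    rw [this]
    exact mul_le_mul_of_nonneg_left hKr (by positivity)
  have h2 : 2 * (ε / (2 * (1 + 4 * π)) + 4 * π * (ε / (2 * (1 + 4 * π)))) = ε := by
    field_simp
  linarith

/-- **Contrapositive form (the input of the blow-up step).** With `δ` as above: if `u` is NOT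
backward bounded at `(T, x₀)`, then for every scale `0 < r₁` with `K r₁² ≤ δ` and every
`0 ≤ t₁ < T` there is a time `t ∈ (t₁, T)` at which the probe energy at scale `r₁` exceeds `δ`:
the smoothed scaled kinetic energy at a singular point does not become small at any fixed small
scale as `t ↑ T`. [cite: SereginSverak2002, Lemma 3.3 (restated verbatim BarkerWang2023 §3 Lemma 1)] -/
theorem frequently_probeEnergy_gt_of_not_isBackwardBoundedAt (hP : ContDiff ℝ ∞ P)
    (hPb : ContDiff ℝ ∞ Pb)
    (hode : ∀ σ, Pb σ + 2 / 3 * σ * deriv Pb σ = P σ) (hP0 : ∀ σ, 1 ≤ σ → P σ = 0)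
    (hPnn : ∀ σ, 0 ≤ P σ) (hPle : ∀ σ, P σ ≤ Pb σ) (hPble : ∀ σ, Pb σ ≤ 1)
    (hPb1 : ∀ σ, σ ≤ 1 / 4 → Pb σ = 1) (hPb' : ∀ σ, deriv Pb σ ≤ 0) :
    ∃ δ : ℝ, 0 < δ ∧
    ∀ (T : ℝ) (u : ℝ → EuclideanSpace ℝ (Fin 3) → EuclideanSpace ℝ (Fin 3))
      (p : ℝ → EuclideanSpace ℝ (Fin 3) → ℝ), 0 < T →
      IsClassicalNSSolutionOn (Ico 0 T) 1 0 u p → IsLerayHopfOn T 1 0 (u 0) u →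
      ∀ (K : ℝ), 0 ≤ K →
      ((∀ t ∈ Ioo 0 T, ∀ x, ‖u t x‖ ^ 2 / 2 + normalisedPressure (u t) x ≤ K) ∨
        (∀ t ∈ Ioo 0 T, ∀ x, -K ≤ normalisedPressure (u t) x)) →
      ∀ (x₀ : EuclideanSpace ℝ (Fin 3)), ¬ IsBackwardBoundedAt u T x₀ →
        ∀ (r₁ t₁ : ℝ), 0 < r₁ → 0 ≤ t₁ → t₁ < T → K * r₁ ^ 2 ≤ δ →
          ∃ t ∈ Ioo t₁ T, δ < ∫ x, ‖u t x‖ ^ 2 * (r₁⁻¹ * Pb (‖x - x₀‖ ^ 2 / r₁ ^ 2)) := by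
  obtain ⟨δ, hδ, h⟩ := isBackwardBoundedAt_of_probeEnergy_le hP hPb hode hP0 hPnn hPle hPble hPb1 hPb'
  refine ⟨δ, hδ, fun T u p hT hsol hLH K hK hone x₀ hnot r₁ t₁ hr₁ ht₁ ht₁T hKr => ?_⟩
  by_contra hcon
  push Not at hcon
  exact hnot (h T u p hT hsol hLH K hK hone x₀ r₁ t₁ hr₁ ht₁ ht₁T hKr hcon)

end SereginSverak2002

end Literature.Analysis.FluidPDE

end
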